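import Mathlib
import HarnessLib
import Literature.Analysis.FluidPDE.NSBoundedMildOseenDuhamel
import Summits.NavierStokesRegularity.NavierStokesRegularity.Theorems.PoloidalWindowDoorPoloidalWindowRigidityBumpRates

/-!
# Route `PoloidalWindowDoor`, crux `PoloidalWindowRigidity` (K2, stmt-NavierStokesRegularity-19708) —
# THE DUHAMEL TERM OF A BOUNDED FIELD AGAINST A SCALAR BUMP is `O((t−s)M²/R)`

Cell ns-regularity-ideate, seat nsreg-p7 (gen 6, third worker under the K2 lead; `--supports stmt-…-19708`).
Assembly of the kernel bricks `…OseenBumpPairing` / `…BumpRates` into the bound on the Oseen–Duhamel term of a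
field bounded by `M` on `(s,t) × ℝ³`, tested against the vector bump `θ e` (`θ` a scalar test function):

  `|∫ ⟪B¹_s(v,v)(t), θe⟫| ≤ M²‖e‖(t−s) [ ∫‖Dθ‖ + 2^{3/2}·2R·∫‖D²θ‖ + K_Θ·(2/R)·∫|θ| ]`   (every `R > 0`)

(`abs_integral_inner_oseenDuhamel_le`).  Steps: Fubini for the pairing
(`integral_inner_oseenDuhamel_eq_setIntegral`); the tested kernel at `(τ, y)` is heat part + projector slices
(`integral_inner_oseenKernel_comp_sub`) with the pointwise majorant `ofReal_norm_testedKernel_le` (near regime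
`s' ≤ R²`: two integrations by parts; far regime: the scalar majorant of `Θ_{s'}`); Tonelli in `ℝ≥0∞` and the
`y`-integrated / time-integrated rates (`lintegral_lintegral_majorant_le`).  This is the (M)-side input of the
LARGE-SCALE MOMENTUM CONSERVATION (`…LargeScaleMomentum`) on the discharge path of the K2 lead's hypothesis (F1).

WHAT THIS IS NOT: not a claim about Navier–Stokes regularity and not the open residue S2⁗ — an estimate for
the bilinear Oseen term of bounded fields (bears_on LADDER-NS N0 via crux K2 = stmt-19708; whole-class tool).
-/

noncomputable section

-- the summit and its single sub-problem share the name (CONVENTIONS §1), as in every Theorems file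
set_option linter.dupNamespace false
-- nested operator types `ℝ³ →L[ℝ] ℝ³ →L[ℝ] ℝ`
set_option maxSynthPendingDepth 3

namespace Summit.NavierStokesRegularity.NavierStokesRegularity.Theorems.PoloidalWindowDoorPoloidalWindowRigidityDuhamelBump

open MeasureTheory Set Function Filter Topology Metric InnerProductSpace
open scoped RealInnerProductSpace ENNReal NNReal Laplacian ContDiff
open Literature.Analysis Literature.Analysis.FluidPDE Literature.Analysis.UnboundedOperators
open Summit.NavierStokesRegularity.NavierStokesRegularity.Theorems.PoloidalWindowDoorPoloidalWindowRigidityOseenBumpPairing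
open Summit.NavierStokesRegularity.NavierStokesRegularity.Theorems.PoloidalWindowDoorPoloidalWindowRigidityBumpRates

/-! ## Measurability of the heat majorant; the caloric extension of `θ e` -/

/-- Measurability of `(σ, y) ↦ ∫ G_σ(x − y) ‖Dθ(x)‖ dx`. [folklore] -/
theorem measurable_heatIntegrand {θ : EuclideanSpace ℝ (Fin 3) → ℝ}
    (hθ : FunctionSpaces.IsTestFunctionOn (⊤ : TopologicalSpace.Opens (EuclideanSpace ℝ (Fin 3))) θ) :
    Measurable fun p : ℝ × EuclideanSpace ℝ (Fin 3) => ∫ x, heatKernel p.1 (x - p.2) * ‖fderiv ℝ θ x‖ := by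
  have hθ1 : ContDiff ℝ 1 θ := contDiff_infty.1 hθ.contDiff 1
  have hK : Measurable fun q : (ℝ × EuclideanSpace ℝ (Fin 3)) × EuclideanSpace ℝ (Fin 3) =>
      heatKernel q.1.1 (q.2 - q.1.2) :=
    measurable_heatKernel_uncurry.comp (measurable_fst.fst.prodMk (measurable_snd.sub measurable_fst.snd))
  have hF : Measurable fun q : (ℝ × EuclideanSpace ℝ (Fin 3)) × EuclideanSpace ℝ (Fin 3) =>
      heatKernel q.1.1 (q.2 - q.1.2) * ‖fderiv ℝ θ q.2‖ :=
    hK.mul (((hθ1.continuous_fderiv one_ne_zero).comp continuous_snd).measurable.norm)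
  exact (hF.stronglyMeasurable.integral_prod_right').measurable

/-- `e^{σΔ}(θ e)(x) = (e^{σΔ}θ)(x) e`. [folklore] -/
theorem heatExtension_smul_const (θ : EuclideanSpace ℝ (Fin 3) → ℝ) (e : EuclideanSpace ℝ (Fin 3)) (σ : ℝ)
    (x : EuclideanSpace ℝ (Fin 3)) :
    heatExtension (fun y => θ y • e) σ x = heatExtension θ σ x • e := by
  rw [heatExtension_apply, heatExtension_apply, ← integral_smul_const]
  refine integral_congr_ae (Eventually.of_forall fun y => ?_)
  simp only [smul_smul, smul_eq_mul]

/-! ## The Duhamel term against a scalar bump -/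

section Duhamel

variable {v : ℝ → EuclideanSpace ℝ (Fin 3) → EuclideanSpace ℝ (Fin 3)} {s t M R : ℝ}
  {θ : EuclideanSpace ℝ (Fin 3) → ℝ}

/-- **The tested Oseen kernel of a bounded field, pointwise majorant.** For `τ ∈ (s,t)`, `y`, `|a| ≤ M`:
`‖∫⟪K(t−τ, x−y)[a,a], θ(x)e⟫dx‖ ≤ M²|e| (h(t−τ,y) + ∫_{s'>0} J(s',y) ds')` with the heat majorant `h` and the
near/far majorant `J` (switching at `s' = R²`). [folklore] -/
theorem ofReal_norm_testedKernel_le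
    (hθ : FunctionSpaces.IsTestFunctionOn (⊤ : TopologicalSpace.Opens (EuclideanSpace ℝ (Fin 3))) θ)
    (e : EuclideanSpace ℝ (Fin 3)) (hM0 : 0 ≤ M) (R : ℝ) {σ : ℝ} (hσ : 0 < σ) (y a : EuclideanSpace ℝ (Fin 3))
    (ha : ‖a‖ ≤ M) :
    ENNReal.ofReal ‖∫ x, ⟪oseenKernel σ (x - y) a a, θ x • e⟫‖ ≤
      ENNReal.ofReal (M ^ 2 * ‖e‖) *
        (ENNReal.ofReal (∫ x, heatKernel σ (x - y) * ‖fderiv ℝ θ x‖) +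
          ∫⁻ s' in Ioi (0 : ℝ),
            (if s' ≤ R ^ 2 then ENNReal.ofReal (∫ x, ‖fderiv ℝ (heatKernel s') (x - y)‖ * ‖fderiv ℝ (fderiv ℝ θ) x‖)
              else ENNReal.ofReal (∫ x, (3 * (heatKernel s' (x - y) / (4 * s' ^ 2)) * ‖x - y‖ +
                heatKernel s' (x - y) / (8 * s' ^ 3) * ‖x - y‖ ^ 3) * |θ x|))) := by
  have hw : Continuous fun x => θ x • e := hθ.contDiff.continuous.smul continuous_const
  have hwc : HasCompactSupport fun x => θ x • e := hθ.hasCompactSupport.smul_right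
  have haa : ‖a‖ * ‖a‖ * ‖e‖ ≤ M ^ 2 * ‖e‖ := by
    rw [sq]
    exact mul_le_mul_of_nonneg_right (mul_le_mul ha ha (norm_nonneg _) hM0) (norm_nonneg _)
  rw [integral_inner_oseenKernel_comp_sub hσ y a a hw hwc]
  -- heat part
  have hH := abs_heatPart_le hθ hσ y a a e
  have hH' : ENNReal.ofReal ‖∫ x, fderiv ℝ (heatKernel σ) (x - y) a * ⟪a, θ x • e⟫‖ ≤
      ENNReal.ofReal (M ^ 2 * ‖e‖) * ENNReal.ofReal (∫ x, heatKernel σ (x - y) * ‖fderiv ℝ θ x‖) := by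
    rw [← ENNReal.ofReal_mul (by positivity), Real.norm_eq_abs]
    refine ENNReal.ofReal_le_ofReal (hH.trans ?_)
    exact mul_le_mul_of_nonneg_right haa
      (integral_nonneg fun x => mul_nonneg (heatKernel_pos hσ _).le (norm_nonneg _))
  -- projector part, slice by slice
  have hP : ENNReal.ofReal ‖∫ s' in Ioi σ, ∫ x, ⟪oseenIntegrand s' (x - y) a a, θ x • e⟫‖ ≤
      ENNReal.ofReal (M ^ 2 * ‖e‖) * ∫⁻ s' in Ioi (0 : ℝ),
        (if s' ≤ R ^ 2 then ENNReal.ofReal (∫ x, ‖fderiv ℝ (heatKernel s') (x - y)‖ * ‖fderiv ℝ (fderiv ℝ θ) x‖)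
          else ENNReal.ofReal (∫ x, (3 * (heatKernel s' (x - y) / (4 * s' ^ 2)) * ‖x - y‖ +
            heatKernel s' (x - y) / (8 * s' ^ 3) * ‖x - y‖ ^ 3) * |θ x|)) := by
    refine (ENNReal.ofReal_le_of_le_toReal (norm_integral_le_lintegral_norm _)).trans ?_
    rw [← lintegral_const_mul' _ _ ENNReal.ofReal_ne_top]
    refine (lintegral_mono' (Measure.restrict_mono (Ioi_subset_Ioi hσ.le) le_rfl) le_rfl).trans ?_
    refine lintegral_mono_ae ?_
    filter_upwards [ae_restrict_mem measurableSet_Ioi] with s' hs'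
    have hs'0 : 0 < s' := hs'
    rw [Real.norm_eq_abs]
    split_ifs with hle
    · rw [← ENNReal.ofReal_mul (by positivity)]
      refine ENNReal.ofReal_le_ofReal ((abs_projSlice_le_near hθ s' y a a e).trans ?_)
      exact mul_le_mul_of_nonneg_right haa (integral_nonneg fun x => by positivity)
    · rw [← ENNReal.ofReal_mul (by positivity)]
      refine ENNReal.ofReal_le_ofReal ((abs_projSlice_le_far hθ hs'0 y a a e).trans ?_)
      exact mul_le_mul_of_nonneg_right haa
        (integral_nonneg fun x => mul_nonneg (majorant_nonneg hs'0 _) (abs_nonneg _))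
  calc ENNReal.ofReal ‖(∫ x, fderiv ℝ (heatKernel σ) (x - y) a * ⟪a, θ x • e⟫) +
          ∫ s' in Ioi σ, ∫ x, ⟪oseenIntegrand s' (x - y) a a, θ x • e⟫‖
      ≤ ENNReal.ofReal (‖∫ x, fderiv ℝ (heatKernel σ) (x - y) a * ⟪a, θ x • e⟫‖ +
          ‖∫ s' in Ioi σ, ∫ x, ⟪oseenIntegrand s' (x - y) a a, θ x • e⟫‖) :=
        ENNReal.ofReal_le_ofReal (norm_add_le _ _)
    _ = ENNReal.ofReal ‖∫ x, fderiv ℝ (heatKernel σ) (x - y) a * ⟪a, θ x • e⟫‖ +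
          ENNReal.ofReal ‖∫ s' in Ioi σ, ∫ x, ⟪oseenIntegrand s' (x - y) a a, θ x • e⟫‖ :=
        ENNReal.ofReal_add (norm_nonneg _) (norm_nonneg _)
    _ ≤ _ := by rw [mul_add]; exact add_le_add hH' hP

/-- **The time integral of the near/far majorant:** `∫_{s'>0} ∫⁻_y J(s',y) ≤ 2^{3/2}·2R·‖D²θ‖₁ + K_Θ·(2/R)·‖θ‖₁`.
[folklore] -/
theorem lintegral_lintegral_majorant_le
    (hθ : FunctionSpaces.IsTestFunctionOn (⊤ : TopologicalSpace.Opens (EuclideanSpace ℝ (Fin 3))) θ)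
    (hR : 0 < R) :
    ∫⁻ y : EuclideanSpace ℝ (Fin 3), ∫⁻ s' in Ioi (0 : ℝ),
        (if s' ≤ R ^ 2 then ENNReal.ofReal (∫ x, ‖fderiv ℝ (heatKernel s') (x - y)‖ * ‖fderiv ℝ (fderiv ℝ θ) x‖)
          else ENNReal.ofReal (∫ x, (3 * (heatKernel s' (x - y) / (4 * s' ^ 2)) * ‖x - y‖ +
            heatKernel s' (x - y) / (8 * s' ^ 3) * ‖x - y‖ ^ 3) * |θ x|)) ≤
      ENNReal.ofReal ((2 : ℝ) ^ ((Module.finrank ℝ (EuclideanSpace ℝ (Fin 3)) : ℝ) / 2) * (2 * R)) *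
          (∫⁻ x, ENNReal.ofReal ‖fderiv ℝ (fderiv ℝ θ) x‖) +
        ENNReal.ofReal (((3 / 2) * (2 : ℝ) ^ ((Module.finrank ℝ (EuclideanSpace ℝ (Fin 3)) : ℝ) / 2) +
            8 * 64 * ((2 : ℝ) ^ ((Module.finrank ℝ (EuclideanSpace ℝ (Fin 3)) : ℝ) / 2)) ^ 3) * (2 / R)) *
          ∫⁻ x, ENNReal.ofReal |θ x| := by
  set cE : ℝ := (2 : ℝ) ^ ((Module.finrank ℝ (EuclideanSpace ℝ (Fin 3)) : ℝ) / 2) with hcE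
  set KΘ : ℝ := (3 / 2) * cE + 8 * 64 * cE ^ 3 with hKΘ
  have hcE0 : 0 ≤ cE := two_rpow_pos.le
  have hKΘ0 : 0 ≤ KΘ := by positivity
  set D₂ : ℝ≥0∞ := ∫⁻ x, ENNReal.ofReal ‖fderiv ℝ (fderiv ℝ θ) x‖ with hD₂
  set D₀ : ℝ≥0∞ := ∫⁻ x, ENNReal.ofReal |θ x| with hD₀
  set J : ℝ × EuclideanSpace ℝ (Fin 3) → ℝ≥0∞ := fun p =>
    if p.1 ≤ R ^ 2 then ENNReal.ofReal (∫ x, ‖fderiv ℝ (heatKernel p.1) (x - p.2)‖ * ‖fderiv ℝ (fderiv ℝ θ) x‖)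
    else ENNReal.ofReal (∫ x, (3 * (heatKernel p.1 (x - p.2) / (4 * p.1 ^ 2)) * ‖x - p.2‖ +
      heatKernel p.1 (x - p.2) / (8 * p.1 ^ 3) * ‖x - p.2‖ ^ 3) * |θ x|) with hJ
  have hJm : Measurable J :=
    Measurable.ite (measurableSet_le measurable_fst measurable_const)
      (measurable_nearIntegrand hθ).ennreal_ofReal (measurable_farIntegrand hθ).ennreal_ofReal
  -- swap the integrals
  have hswap : ∫⁻ y : EuclideanSpace ℝ (Fin 3), ∫⁻ s' in Ioi (0 : ℝ), J (s', y) =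
      ∫⁻ s' in Ioi (0 : ℝ), ∫⁻ y : EuclideanSpace ℝ (Fin 3), J (s', y) :=
    lintegral_lintegral_swap ((hJm.comp measurable_swap).aemeasurable)
  change ∫⁻ y : EuclideanSpace ℝ (Fin 3), ∫⁻ s' in Ioi (0 : ℝ), J (s', y) ≤ _
  rw [hswap]
  -- the bound slice by slice
  set jb : ℝ → ℝ≥0∞ := fun s' =>
    if s' ≤ R ^ 2 then ENNReal.ofReal (cE * s' ^ (-(1 / 2 : ℝ))) * D₂
    else ENNReal.ofReal (KΘ * (s' ^ (-(1 / 2 : ℝ))) ^ 3) * D₀ with hjb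
  have hle : ∀ s' ∈ Ioi (0 : ℝ), ∫⁻ y : EuclideanSpace ℝ (Fin 3), J (s', y) ≤ jb s' := by
    intro s' hs'
    have hs'0 : 0 < s' := hs'
    simp only [hJ, hjb]
    split_ifs with h
    · exact nearRate hθ hs'0
    · exact farRate hθ hs'0
  refine (lintegral_mono_ae (by filter_upwards [ae_restrict_mem measurableSet_Ioi] with s' hs'; exact hle s' hs')).trans ?_
  -- split the time axis at `R²`
  have hR2 : 0 < R ^ 2 := by positivity
  have hunion : Ioi (0 : ℝ) = Ioc 0 (R ^ 2) ∪ Ioi (R ^ 2) := (Ioc_union_Ioi_eq_Ioi hR2.le).symm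
  rw [hunion, lintegral_union measurableSet_Ioi
    (Set.disjoint_left.2 fun x hx hx' => not_lt.2 hx.2 (mem_Ioi.1 hx'))]
  have hm1 : Measurable fun s' : ℝ => ENNReal.ofReal (cE * s' ^ (-(1 / 2 : ℝ))) :=
    ((measurable_id.pow_const _).const_mul cE).ennreal_ofReal
  have hm2 : Measurable fun s' : ℝ => ENNReal.ofReal (KΘ * (s' ^ (-(1 / 2 : ℝ))) ^ 3) :=
    (((measurable_id.pow_const _).pow_const 3).const_mul KΘ).ennreal_ofReal
  have h1 : ∫⁻ s' in Ioc (0 : ℝ) (R ^ 2), jb s' = ENNReal.ofReal (cE * (2 * R)) * D₂ :=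
    calc ∫⁻ s' in Ioc (0 : ℝ) (R ^ 2), jb s'
        = ∫⁻ s' in Ioc (0 : ℝ) (R ^ 2), ENNReal.ofReal (cE * s' ^ (-(1 / 2 : ℝ))) * D₂ :=
          setLIntegral_congr_fun measurableSet_Ioc fun s' hs' => by simp only [hjb, if_pos hs'.2]
      _ = (∫⁻ s' in Ioc (0 : ℝ) (R ^ 2), ENNReal.ofReal (cE * s' ^ (-(1 / 2 : ℝ)))) * D₂ :=
          lintegral_mul_const _ hm1
      _ = ENNReal.ofReal (cE * (2 * R)) * D₂ := by rw [lintegral_Ioc_rate hR cE hcE0]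
  have h2 : ∫⁻ s' in Ioi (R ^ 2), jb s' = ENNReal.ofReal (KΘ * (2 / R)) * D₀ :=
    calc ∫⁻ s' in Ioi (R ^ 2), jb s'
        = ∫⁻ s' in Ioi (R ^ 2), ENNReal.ofReal (KΘ * (s' ^ (-(1 / 2 : ℝ))) ^ 3) * D₀ :=
          setLIntegral_congr_fun measurableSet_Ioi fun s' hs' => by
            simp only [hjb, if_neg (not_le.2 (mem_Ioi.1 hs'))]
      _ = (∫⁻ s' in Ioi (R ^ 2), ENNReal.ofReal (KΘ * (s' ^ (-(1 / 2 : ℝ))) ^ 3)) * D₀ :=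
          lintegral_mul_const _ hm2
      _ = ENNReal.ofReal (KΘ * (2 / R)) * D₀ := by rw [lintegral_Ioi_rate hR KΘ hKΘ0]
  rw [h1, h2]

/-- **The Duhamel term of a bounded field against a scalar bump.** [folklore] -/
theorem abs_integral_inner_oseenDuhamel_le (hst : s < t) (hM0 : 0 ≤ M) (hR : 0 < R)
    (hmeas : AEStronglyMeasurable (uncurry v)
      ((volume : Measure (ℝ × EuclideanSpace ℝ (Fin 3))).restrict (Ioo s t ×ˢ univ)))
    (hM : ∀ τ ∈ Ioo s t, ∀ y, ‖v τ y‖ ≤ M)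
    (hθ : FunctionSpaces.IsTestFunctionOn (⊤ : TopologicalSpace.Opens (EuclideanSpace ℝ (Fin 3))) θ)
    (e : EuclideanSpace ℝ (Fin 3)) :
    |∫ x, ⟪oseenDuhamel 1 s v v t x, θ x • e⟫| ≤
      M ^ 2 * ‖e‖ * (t - s) * ((∫ x, ‖fderiv ℝ θ x‖) +
        (2 : ℝ) ^ ((Module.finrank ℝ (EuclideanSpace ℝ (Fin 3)) : ℝ) / 2) * (2 * R) *
          (∫ x, ‖fderiv ℝ (fderiv ℝ θ) x‖) +
        ((3 / 2) * (2 : ℝ) ^ ((Module.finrank ℝ (EuclideanSpace ℝ (Fin 3)) : ℝ) / 2) +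
          8 * 64 * ((2 : ℝ) ^ ((Module.finrank ℝ (EuclideanSpace ℝ (Fin 3)) : ℝ) / 2)) ^ 3) * (2 / R) *
          ∫ x, |θ x|) := by
  set cE : ℝ := (2 : ℝ) ^ ((Module.finrank ℝ (EuclideanSpace ℝ (Fin 3)) : ℝ) / 2) with hcE
  set KΘ : ℝ := (3 / 2) * cE + 8 * 64 * cE ^ 3 with hKΘ
  have hcE0 : 0 ≤ cE := two_rpow_pos.le
  have hKΘ0 : 0 ≤ KΘ := by positivity
  have hθ1 : ContDiff ℝ 1 θ := contDiff_infty.1 hθ.contDiff 1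
  have hθ2 : ContDiff ℝ 2 θ := contDiff_infty.1 hθ.contDiff 2
  have hw : Continuous fun x => θ x • e := hθ.contDiff.continuous.smul continuous_const
  have hwc : HasCompactSupport fun x => θ x • e := hθ.hasCompactSupport.smul_right
  -- the three real masses and their Lebesgue versions
  set D₁r : ℝ := ∫ x, ‖fderiv ℝ θ x‖ with hD₁r
  set D₂r : ℝ := ∫ x, ‖fderiv ℝ (fderiv ℝ θ) x‖ with hD₂r
  set D₀r : ℝ := ∫ x, |θ x| with hD₀r
  have hD₁i : Integrable (fun x => ‖fderiv ℝ θ x‖) volume :=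
    (hθ1.continuous_fderiv one_ne_zero).norm.integrable_of_hasCompactSupport
      (hθ.hasCompactSupport.fderiv (𝕜 := ℝ)).norm
  have hD₂i : Integrable (fun x => ‖fderiv ℝ (fderiv ℝ θ) x‖) volume :=
    ((hθ2.fderiv_right (m := 1) le_rfl).continuous_fderiv one_ne_zero).norm.integrable_of_hasCompactSupport
      ((hθ.hasCompactSupport.fderiv (𝕜 := ℝ)).fderiv (𝕜 := ℝ)).norm
  have hD₀i : Integrable (fun x => |θ x|) volume :=
    (continuous_abs.comp hθ.contDiff.continuous).integrable_of_hasCompactSupport hθ.hasCompactSupport.norm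
  have hD₁ : ∫⁻ x, ENNReal.ofReal ‖fderiv ℝ θ x‖ = ENNReal.ofReal D₁r :=
    (ofReal_integral_eq_lintegral_ofReal hD₁i (Eventually.of_forall fun x => norm_nonneg _)).symm
  have hD₂ : ∫⁻ x, ENNReal.ofReal ‖fderiv ℝ (fderiv ℝ θ) x‖ = ENNReal.ofReal D₂r :=
    (ofReal_integral_eq_lintegral_ofReal hD₂i (Eventually.of_forall fun x => norm_nonneg _)).symm
  have hD₀ : ∫⁻ x, ENNReal.ofReal |θ x| = ENNReal.ofReal D₀r :=
    (ofReal_integral_eq_lintegral_ofReal hD₀i (Eventually.of_forall fun x => abs_nonneg _)).symm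
  have hD₁0 : 0 ≤ D₁r := integral_nonneg fun x => norm_nonneg _
  have hD₂0 : 0 ≤ D₂r := integral_nonneg fun x => norm_nonneg _
  have hD₀0 : 0 ≤ D₀r := integral_nonneg fun x => abs_nonneg _
  -- Fubini for the Duhamel pairing
  obtain ⟨-, hF⟩ := integral_inner_oseenDuhamel_eq_setIntegral one_pos hmeas hmeas hM0 hM hM hst le_rfl hw hwc
  rw [hF]
  set μ : Measure (ℝ × EuclideanSpace ℝ (Fin 3)) :=
    (volume : Measure (ℝ × EuclideanSpace ℝ (Fin 3))).restrict (Ioo s t ×ˢ univ) with hμ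
  set Φ : ℝ × EuclideanSpace ℝ (Fin 3) → ℝ := fun p =>
    ∫ x, ⟪oseenKernel (1 * (t - p.1)) (x - p.2) (v p.1 p.2) (v p.1 p.2), θ x • e⟫ with hΦ
  -- the majorant
  set J : ℝ × EuclideanSpace ℝ (Fin 3) → ℝ≥0∞ := fun p =>
    if p.1 ≤ R ^ 2 then ENNReal.ofReal (∫ x, ‖fderiv ℝ (heatKernel p.1) (x - p.2)‖ * ‖fderiv ℝ (fderiv ℝ θ) x‖)
    else ENNReal.ofReal (∫ x, (3 * (heatKernel p.1 (x - p.2) / (4 * p.1 ^ 2)) * ‖x - p.2‖ +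
      heatKernel p.1 (x - p.2) / (8 * p.1 ^ 3) * ‖x - p.2‖ ^ 3) * |θ x|) with hJ
  have hJm : Measurable J :=
    Measurable.ite (measurableSet_le measurable_fst measurable_const)
      (measurable_nearIntegrand hθ).ennreal_ofReal (measurable_farIntegrand hθ).ennreal_ofReal
  set Jint : EuclideanSpace ℝ (Fin 3) → ℝ≥0∞ := fun y => ∫⁻ s' in Ioi (0 : ℝ), J (s', y) with hJint
  have hJintm : Measurable Jint := hJm.lintegral_prod_left'
  have hJ2 : Measurable fun p : ℝ × EuclideanSpace ℝ (Fin 3) => Jint p.2 := hJintm.comp measurable_snd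
  set Hm : ℝ × EuclideanSpace ℝ (Fin 3) → ℝ≥0∞ := fun p =>
    ENNReal.ofReal (∫ x, heatKernel (t - p.1) (x - p.2) * ‖fderiv ℝ θ x‖) with hHm
  have hHmm : Measurable Hm :=
    ((measurable_heatIntegrand hθ).comp ((measurable_const.sub measurable_fst).prodMk measurable_snd)).ennreal_ofReal
  set G : ℝ × EuclideanSpace ℝ (Fin 3) → ℝ≥0∞ := fun p =>
    ENNReal.ofReal (M ^ 2 * ‖e‖) * (Hm p + Jint p.2) with hG
  -- pointwise bound a.e. on the slab
  have hpt : ∀ᵐ p ∂μ, ENNReal.ofReal ‖Φ p‖ ≤ G p := by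
    rw [hμ]
    filter_upwards [ae_restrict_mem (measurableSet_Ioo.prod MeasurableSet.univ)] with p hp
    have hτ : p.1 ∈ Ioo s t := (mem_prod.1 hp).1
    have hσ : 0 < t - p.1 := by linarith [hτ.2]
    have h := ofReal_norm_testedKernel_le hθ e hM0 R hσ p.2 (v p.1 p.2) (hM p.1 hτ p.2)
    simp only [hΦ, one_mul]
    exact h
  -- integrate the majorant
  have hμprod : μ = ((volume : Measure ℝ).restrict (Ioo s t)).prod (volume : Measure (EuclideanSpace ℝ (Fin 3))) := by
    rw [hμ, volume_restrict_prod_univ_eq_prod]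
  have hvol : (volume : Measure ℝ) (Ioo s t) = ENNReal.ofReal (t - s) := Real.volume_Ioo
  have hA : ∫⁻ p, Hm p ∂μ ≤ ENNReal.ofReal (t - s) * ENNReal.ofReal D₁r := by
    rw [hμprod, lintegral_prod _ hHmm.aemeasurable]
    calc ∫⁻ τ in Ioo s t, ∫⁻ y, Hm (τ, y)
        ≤ ∫⁻ τ in Ioo s t, ENNReal.ofReal D₁r := by
          refine lintegral_mono_ae ?_
          filter_upwards [ae_restrict_mem measurableSet_Ioo] with τ hτ
          have hσ : 0 < t - τ := by linarith [hτ.2]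
          rw [← hD₁]
          exact heatRate hθ hσ
      _ = ENNReal.ofReal (t - s) * ENNReal.ofReal D₁r := by
          rw [setLIntegral_const, hvol, mul_comm]
  have hB : ∫⁻ p, Jint p.2 ∂μ ≤ ENNReal.ofReal (t - s) *
      (ENNReal.ofReal (cE * (2 * R)) * ENNReal.ofReal D₂r + ENNReal.ofReal (KΘ * (2 / R)) * ENNReal.ofReal D₀r) := by
    rw [hμprod, lintegral_prod _ hJ2.aemeasurable]
    have hin : ∫⁻ y : EuclideanSpace ℝ (Fin 3), Jint y ≤
        ENNReal.ofReal (cE * (2 * R)) * ENNReal.ofReal D₂r + ENNReal.ofReal (KΘ * (2 / R)) * ENNReal.ofReal D₀r := by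
      rw [← hD₂, ← hD₀]
      exact lintegral_lintegral_majorant_le hθ hR
    calc ∫⁻ τ in Ioo s t, ∫⁻ y : EuclideanSpace ℝ (Fin 3), Jint y
        ≤ ∫⁻ τ in Ioo s t, (ENNReal.ofReal (cE * (2 * R)) * ENNReal.ofReal D₂r +
            ENNReal.ofReal (KΘ * (2 / R)) * ENNReal.ofReal D₀r) := lintegral_mono fun τ => hin
      _ = _ := by rw [setLIntegral_const, hvol, mul_comm]
  have hGint : ∫⁻ p, G p ∂μ ≤ ENNReal.ofReal (M ^ 2 * ‖e‖ * (t - s) *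
      (D₁r + cE * (2 * R) * D₂r + KΘ * (2 / R) * D₀r)) := by
    have hsum : Measurable fun p : ℝ × EuclideanSpace ℝ (Fin 3) => Hm p + Jint p.2 := hHmm.add hJ2
    have hts : 0 ≤ t - s := by linarith
    calc ∫⁻ p, G p ∂μ = ENNReal.ofReal (M ^ 2 * ‖e‖) * ∫⁻ p, (Hm p + Jint p.2) ∂μ := lintegral_const_mul _ hsum
      _ = ENNReal.ofReal (M ^ 2 * ‖e‖) * (∫⁻ p, Hm p ∂μ + ∫⁻ p, Jint p.2 ∂μ) := by
          rw [lintegral_add_left hHmm]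
      _ ≤ ENNReal.ofReal (M ^ 2 * ‖e‖) * (ENNReal.ofReal (t - s) * ENNReal.ofReal D₁r +
            ENNReal.ofReal (t - s) * (ENNReal.ofReal (cE * (2 * R)) * ENNReal.ofReal D₂r +
              ENNReal.ofReal (KΘ * (2 / R)) * ENNReal.ofReal D₀r)) := by gcongr
      _ = ENNReal.ofReal (M ^ 2 * ‖e‖ * (t - s) * (D₁r + cE * (2 * R) * D₂r + KΘ * (2 / R) * D₀r)) := by
          rw [← ENNReal.ofReal_mul hts, ← ENNReal.ofReal_mul (by positivity),
            ← ENNReal.ofReal_mul (by positivity), ← ENNReal.ofReal_add (by positivity) (by positivity),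
            ← ENNReal.ofReal_mul hts, ← ENNReal.ofReal_add (by positivity) (by positivity),
            ← ENNReal.ofReal_mul (by positivity)]
          congr 1
          ring
  -- conclude
  have hfin : ∫⁻ p, ENNReal.ofReal ‖Φ p‖ ∂μ ≤ ENNReal.ofReal (M ^ 2 * ‖e‖ * (t - s) *
      (D₁r + cE * (2 * R) * D₂r + KΘ * (2 / R) * D₀r)) := (lintegral_mono_ae hpt).trans hGint
  have hnn : 0 ≤ M ^ 2 * ‖e‖ * (t - s) * (D₁r + cE * (2 * R) * D₂r + KΘ * (2 / R) * D₀r) := by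
    have hts : 0 ≤ t - s := by linarith
    positivity
  calc |∫ p, Φ p ∂μ| = ‖∫ p, Φ p ∂μ‖ := (Real.norm_eq_abs _).symm
    _ ≤ (∫⁻ p, ENNReal.ofReal ‖Φ p‖ ∂μ).toReal := norm_integral_le_lintegral_norm _
    _ ≤ M ^ 2 * ‖e‖ * (t - s) * (D₁r + cE * (2 * R) * D₂r + KΘ * (2 / R) * D₀r) :=
        ENNReal.toReal_le_of_le_ofReal hnn hfin

end Duhamel

end Summit.NavierStokesRegularity.NavierStokesRegularity.Theorems.PoloidalWindowDoorPoloidalWindowRigidityDuhamelBump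

end
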